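import Literature.MathematicalPhysics.QuantumChemistry.VariationalRDMRelaxation
import Literature.MathematicalPhysics.QuantumChemistry.ThreeIndexConditionsT2Prime
import HarnessLib

/-!
# The three-index (`T1`, `T2`, `T2′`) relaxation: the `PQGT1T2′` programme is a lower bound to the
# ground-state energy

Topic `Literature/MathematicalPhysics/QuantumChemistry`; continues `VariationalRDMRelaxation.lean` (the
`D`, `Q`, `G` programme on an abstract pair `(γ, Γ) = (¹D, ²D)`, `IsDQGFeasible`,
`le_groundEnergy_of_forall_isDQGFeasible`) with the THREE-INDEX conditions of
`ThreeIndexConditionsTwoRDM.lean` / `ThreeIndexConditionsT2Prime.lean` (there proved for the reduced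
density matrices of every STATE), in the form printed by M. Nakata, B. J. Braams, K. Fujisawa,
M. Fukuda, J. K. Percus, M. Yamashita, Z. Zhao, J. Chem. Phys. 128 (2008) 164113, §II.A–C:

  §II.A (Zhao et al. 2004, Erdahl 1978): "the matrices `T1` and `T2` defined by … are positive
  semidefinite", each displayed as an explicit functional of `γ` and `Γ`;
  §II.B (Braams–Percus–Zhao 2007; Mazziotti's `T̄2`): `T2′ = ( T2 X ; X† γ )` with
  `X_{(ijk),l} = Γ^{ij}_{lk}`, "obtained by slightly strengthening `T2`";
  §II.C: "there are obvious inclusion relations between the 2-RDMs satisfying `PQG`, `PQGT1`,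
  `PQGT1T2`, and `PQGT1T2′`. Hence … `E_PQG ≤ E_PQGT1 ≤ E_PQGT1T2 ≤ E_PQGT1T2′ ≤ E_fullCI ≤ E_HF`."

Vendored here, finite-dimensional and exact, as the cell `Ventures/CertifiedQuantumChemistry` uses it
(its strongest certified rung is `DQGT1T2′`):

* `t1Map γ Γ`, `t2Map γ Γ` — the printed `T1` / `T2` functionals on an ABSTRACT pair at unit
  normalisation (the right-hand sides of `t1_entry_eq_rdm` / `t2_entry_eq_rdm` with `¹D ↦ γ`, `²D ↦ Γ`,
  `⟨ψ,ψ⟩ ↦ 1`); `t2PrimeMap γ Γ` — the block matrix `( t2Map  X ; X†  γ )` of §II.B;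
  on the reduced density matrices of a unit vector they ARE the `T1`, `T2`, `T2′` matrices of the
  state (`t1Map_rdm`, `t2Map_rdm`, `t2PrimeMap_rdm`);
* `IsDQGT1T2PrimeFeasible N γ Γ` — the FEASIBLE SET of the `PQGT1T2′` programme: DQG feasibility
  (`IsDQGFeasible`) together with `t1Map γ Γ ⪰ 0` and `t2PrimeMap γ Γ ⪰ 0`; the `T2` condition is then a
  THEOREM (`IsDQGT1T2PrimeFeasible.t2Map_posSemidef`: `T2` is the principal `(ijk)`-block of `T2′` —
  the inclusion `PQGT1T2′ ⊆ PQGT1T2` of §II.C), and so is the inclusion in the DQG-feasible set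
  (`IsDQGT1T2PrimeFeasible.toIsDQGFeasible`), whence the bound form of the printed chain
  (`forall_isDQGT1T2PrimeFeasible_of_forall_isDQGFeasible`: a number below the energy functional on
  the DQG-feasible set is below it on the `PQGT1T2′`-feasible set, i.e. `E_PQG ≤ E_PQGT1T2′` for the
  optimal values whenever these exist);
* `IsDQGT1T2PrimeFeasible.of_state` — the conditions are NECESSARY: the pair `(oneRDM ψ, twoRDM ψ)` of
  every unit `N`-particle vector is feasible (from `t1Transpose_posSemidef`, `t2Prime_posSemidef`);
* **`le_groundEnergy_of_forall_isDQGT1T2PrimeFeasible`** — `E_PQGT1T2′ ≤ E_fullCI` in bound form: any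
  `c` below the functional on the `PQGT1T2′`-feasible set satisfies `c ≤ E₀(Ĥ; N)`;
* the `S_z`-SECTOR programme (`IsDQGT1T2PrimeFeasibleSector a b`, `.of_state`,
  **`le_sectorGroundEnergy_of_forall_isDQGT1T2PrimeFeasibleSector`**: `c ≤ E₀(Ĥ; N_α = a, N_β = b)`,
  the quantity of the cell's `DQGT1T2′` rows).

Everything is PROVED (0 sorry); the three definitions carry no content beyond the printed formulas
(they are the state formulas of the tree with the state abstracted away); no named facts. What is NOT
here: the `PQGT1T2` rung as a separate structure (it is `IsDQGT1T2PrimeFeasible` minus `t2Prime_psd`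
plus `t2Map ⪰ 0` — covered by the same two bound theorems since its feasible set contains the
`PQGT1T2′` one and is contained in the DQG one), spin adaptation of the three-index blocks
(Mazziotti 2007 §II.F), existence / attainment of the optimum, and tightness.

## References
* M. Nakata, B. J. Braams, K. Fujisawa, M. Fukuda, J. K. Percus, M. Yamashita, Z. Zhao, J. Chem. Phys.
  128 (2008) 164113, §II.A (`T1`, `T2` as functionals of `γ`, `Γ`), §II.B (`T2′ = (T2 X; X† γ)`),
  §II.C (`E_PQG ≤ E_PQGT1 ≤ E_PQGT1T2 ≤ E_PQGT1T2′ ≤ E_fullCI`) (held copy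
  `paper:doi-10-1063-1-2911696`, PDF p. 5 read). [cite: NakataEtAl2008, §II.A-C]
* B. J. Braams, J. K. Percus, Z. Zhao, *The T1 and T2 representability conditions*, in: D. A. Mazziotti
  (ed.), Reduced-Density-Matrix Mechanics, Adv. Chem. Phys. 134 (Wiley, 2007) 93–101.
  [cite: BraamsPercusZhao2007, §II]
* D. A. Mazziotti, ibid. 21–59, §II.D.2 eqs. (37)–(40), (45) (`T1`, `T2`, `T̄2`).
  [cite: Mazziotti2007RDMChapter, §II.D.2 eqs. (37)-(45)]
* R. M. Erdahl, Int. J. Quantum Chem. 13 (1978) 697–718; Z. Zhao, B. J. Braams, M. Fukuda,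
  M. L. Overton, J. K. Percus, J. Chem. Phys. 120 (2004) 2095 — cited through Nakata et al. (2008)
  refs. 25–26.
-/

noncomputable section

namespace Literature.MathematicalPhysics.QuantumChemistry

open Matrix Finset Literature.MathematicalPhysics.QuantumLattice
open scoped ComplexOrder

/-! ### The three-index maps on abstract pairs -/

section Abstract

variable {ι : Type*} [LinearOrder ι] [Fintype ι]

/-- **The `T1` functional** of an abstract pair `(γ, Γ) = (¹D, ²D)` at unit normalisation:
`T1^{ijk}_{lmn} = Σ ±δ Γ + Σ ±δδ γ + Σ ±δδδ` (9 + 18 + 6 terms) — the matrix whose positive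
semidefiniteness is the `T1` condition, as displayed by Nakata et al. (2008) §II.A (Mazziotti 2007
eq. (39)); it is the right-hand side of `t1_entry_eq_rdm` with the state abstracted away.
[cite: NakataEtAl2008, §II.A] -/
def t1Map (γ : Matrix ι ι ℂ) (Γ : Matrix (ι × ι) (ι × ι) ℂ) : Matrix (ι × ι × ι) (ι × ι × ι) ℂ :=
  Matrix.of fun I J =>
    let i := I.1; let j := I.2.1; let k := I.2.2; let l := J.1; let m := J.2.1; let n := J.2.2
    (if l = i then (1 : ℂ) else 0) * Γ (j, k) (m, n)
    - (if l = j then (1 : ℂ) else 0) * Γ (i, k) (m, n)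
    + (if l = k then (1 : ℂ) else 0) * Γ (i, j) (m, n)
    - (if m = i then (1 : ℂ) else 0) * Γ (j, k) (l, n)
    + (if m = j then (1 : ℂ) else 0) * Γ (i, k) (l, n)
    - (if m = k then (1 : ℂ) else 0) * Γ (i, j) (l, n)
    + (if n = i then (1 : ℂ) else 0) * Γ (j, k) (l, m)
    - (if n = j then (1 : ℂ) else 0) * Γ (i, k) (l, m)
    + (if n = k then (1 : ℂ) else 0) * Γ (i, j) (l, m)
    - (if l = i then (1 : ℂ) else 0) * (if m = j then (1 : ℂ) else 0) * γ k n
    + (if l = i then (1 : ℂ) else 0) * (if m = k then (1 : ℂ) else 0) * γ j n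
    + (if l = i then (1 : ℂ) else 0) * (if n = j then (1 : ℂ) else 0) * γ k m
    - (if l = i then (1 : ℂ) else 0) * (if n = k then (1 : ℂ) else 0) * γ j m
    + (if l = j then (1 : ℂ) else 0) * (if m = i then (1 : ℂ) else 0) * γ k n
    - (if l = j then (1 : ℂ) else 0) * (if m = k then (1 : ℂ) else 0) * γ i n
    - (if l = j then (1 : ℂ) else 0) * (if n = i then (1 : ℂ) else 0) * γ k m
    + (if l = j then (1 : ℂ) else 0) * (if n = k then (1 : ℂ) else 0) * γ i m
    - (if l = k then (1 : ℂ) else 0) * (if m = i then (1 : ℂ) else 0) * γ j n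
    + (if l = k then (1 : ℂ) else 0) * (if m = j then (1 : ℂ) else 0) * γ i n
    + (if l = k then (1 : ℂ) else 0) * (if n = i then (1 : ℂ) else 0) * γ j m
    - (if l = k then (1 : ℂ) else 0) * (if n = j then (1 : ℂ) else 0) * γ i m
    - (if m = i then (1 : ℂ) else 0) * (if n = j then (1 : ℂ) else 0) * γ k l
    + (if m = i then (1 : ℂ) else 0) * (if n = k then (1 : ℂ) else 0) * γ j l
    + (if m = j then (1 : ℂ) else 0) * (if n = i then (1 : ℂ) else 0) * γ k l
    - (if m = j then (1 : ℂ) else 0) * (if n = k then (1 : ℂ) else 0) * γ i l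
    - (if m = k then (1 : ℂ) else 0) * (if n = i then (1 : ℂ) else 0) * γ j l
    + (if m = k then (1 : ℂ) else 0) * (if n = j then (1 : ℂ) else 0) * γ i l
    + (if l = i then (1 : ℂ) else 0) * (if m = j then (1 : ℂ) else 0) * (if n = k then (1 : ℂ) else 0)
    - (if l = i then (1 : ℂ) else 0) * (if m = k then (1 : ℂ) else 0) * (if n = j then (1 : ℂ) else 0)
    - (if l = j then (1 : ℂ) else 0) * (if m = i then (1 : ℂ) else 0) * (if n = k then (1 : ℂ) else 0)
    + (if l = j then (1 : ℂ) else 0) * (if m = k then (1 : ℂ) else 0) * (if n = i then (1 : ℂ) else 0)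
    + (if l = k then (1 : ℂ) else 0) * (if m = i then (1 : ℂ) else 0) * (if n = j then (1 : ℂ) else 0)
    - (if l = k then (1 : ℂ) else 0) * (if m = j then (1 : ℂ) else 0) * (if n = i then (1 : ℂ) else 0)

/-- **The `T2` functional** of an abstract pair at unit normalisation:
`T2^{ijk}_{lmn} = δ_kn Γ^{ij}_{lm} − δ_li Γ^{nj}_{km} + δ_lj Γ^{ni}_{km} + δ_mi Γ^{nj}_{kl} − δ_mj Γ^{ni}_{kl}
  + (δ_li δ_mj − δ_lj δ_mi) γ^n_k` — Nakata et al. (2008) §II.A (Mazziotti 2007 eq. (40)); the right-hand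
side of `t2_entry_eq_rdm` with the state abstracted away. [cite: NakataEtAl2008, §II.A] -/
def t2Map (γ : Matrix ι ι ℂ) (Γ : Matrix (ι × ι) (ι × ι) ℂ) : Matrix (ι × ι × ι) (ι × ι × ι) ℂ :=
  Matrix.of fun I J =>
    let i := I.1; let j := I.2.1; let k := I.2.2; let l := J.1; let m := J.2.1; let n := J.2.2
    (if k = n then (1 : ℂ) else 0) * Γ (i, j) (l, m)
    - (if l = i then (1 : ℂ) else 0) * Γ (n, j) (k, m)
    + (if l = j then (1 : ℂ) else 0) * Γ (n, i) (k, m)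
    + (if m = i then (1 : ℂ) else 0) * Γ (n, j) (k, l)
    - (if m = j then (1 : ℂ) else 0) * Γ (n, i) (k, l)
    + (if l = i then (1 : ℂ) else 0) * (if m = j then (1 : ℂ) else 0) * γ n k
    - (if l = j then (1 : ℂ) else 0) * (if m = i then (1 : ℂ) else 0) * γ n k

/-- **The `T2′` block matrix** of an abstract pair: `T2′ = ( T2  X ; X†  γ )` on the index set
`(ι × ι × ι) ⊕ ι`, with `X_{(ijk), l} = Γ^{ij}_{lk}`, `(X†)_{l, (ijk)} = Γ^{lk}_{ij}` and the 1-matrix in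
the corner. Nakata et al. (2008) §II.B ("we can summarize the four blocks in `T2′` matrix as follows").
[cite: NakataEtAl2008, §II.B] -/
def t2PrimeMap (γ : Matrix ι ι ℂ) (Γ : Matrix (ι × ι) (ι × ι) ℂ) :
    Matrix ((ι × ι × ι) ⊕ ι) ((ι × ι × ι) ⊕ ι) ℂ :=
  Matrix.fromBlocks (t2Map γ Γ)
    (Matrix.of fun (I : ι × ι × ι) (l : ι) => Γ (I.1, I.2.1) (l, I.2.2))
    (Matrix.of fun (l : ι) (I : ι × ι × ι) => Γ (l, I.2.2) (I.1, I.2.1))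
    γ

omit [Fintype ι] in
/-- Entries of the `T1` functional (the printed formula, Nakata et al. (2008) §II.A; `rfl`).
[cite: NakataEtAl2008, §II.A] -/
theorem t1Map_apply (γ : Matrix ι ι ℂ) (Γ : Matrix (ι × ι) (ι × ι) ℂ) (i j k l m n : ι) :
    t1Map γ Γ (i, j, k) (l, m, n) =
      (if l = i then (1 : ℂ) else 0) * Γ (j, k) (m, n)
      - (if l = j then (1 : ℂ) else 0) * Γ (i, k) (m, n)
      + (if l = k then (1 : ℂ) else 0) * Γ (i, j) (m, n)
      - (if m = i then (1 : ℂ) else 0) * Γ (j, k) (l, n)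
      + (if m = j then (1 : ℂ) else 0) * Γ (i, k) (l, n)
      - (if m = k then (1 : ℂ) else 0) * Γ (i, j) (l, n)
      + (if n = i then (1 : ℂ) else 0) * Γ (j, k) (l, m)
      - (if n = j then (1 : ℂ) else 0) * Γ (i, k) (l, m)
      + (if n = k then (1 : ℂ) else 0) * Γ (i, j) (l, m)
      - (if l = i then (1 : ℂ) else 0) * (if m = j then (1 : ℂ) else 0) * γ k n
      + (if l = i then (1 : ℂ) else 0) * (if m = k then (1 : ℂ) else 0) * γ j n
      + (if l = i then (1 : ℂ) else 0) * (if n = j then (1 : ℂ) else 0) * γ k m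
      - (if l = i then (1 : ℂ) else 0) * (if n = k then (1 : ℂ) else 0) * γ j m
      + (if l = j then (1 : ℂ) else 0) * (if m = i then (1 : ℂ) else 0) * γ k n
      - (if l = j then (1 : ℂ) else 0) * (if m = k then (1 : ℂ) else 0) * γ i n
      - (if l = j then (1 : ℂ) else 0) * (if n = i then (1 : ℂ) else 0) * γ k m
      + (if l = j then (1 : ℂ) else 0) * (if n = k then (1 : ℂ) else 0) * γ i m
      - (if l = k then (1 : ℂ) else 0) * (if m = i then (1 : ℂ) else 0) * γ j n
      + (if l = k then (1 : ℂ) else 0) * (if m = j then (1 : ℂ) else 0) * γ i n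
      + (if l = k then (1 : ℂ) else 0) * (if n = i then (1 : ℂ) else 0) * γ j m
      - (if l = k then (1 : ℂ) else 0) * (if n = j then (1 : ℂ) else 0) * γ i m
      - (if m = i then (1 : ℂ) else 0) * (if n = j then (1 : ℂ) else 0) * γ k l
      + (if m = i then (1 : ℂ) else 0) * (if n = k then (1 : ℂ) else 0) * γ j l
      + (if m = j then (1 : ℂ) else 0) * (if n = i then (1 : ℂ) else 0) * γ k l
      - (if m = j then (1 : ℂ) else 0) * (if n = k then (1 : ℂ) else 0) * γ i l
      - (if m = k then (1 : ℂ) else 0) * (if n = i then (1 : ℂ) else 0) * γ j l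
      + (if m = k then (1 : ℂ) else 0) * (if n = j then (1 : ℂ) else 0) * γ i l
      + (if l = i then (1 : ℂ) else 0) * (if m = j then (1 : ℂ) else 0) * (if n = k then (1 : ℂ) else 0)
      - (if l = i then (1 : ℂ) else 0) * (if m = k then (1 : ℂ) else 0) * (if n = j then (1 : ℂ) else 0)
      - (if l = j then (1 : ℂ) else 0) * (if m = i then (1 : ℂ) else 0) * (if n = k then (1 : ℂ) else 0)
      + (if l = j then (1 : ℂ) else 0) * (if m = k then (1 : ℂ) else 0) * (if n = i then (1 : ℂ) else 0)
      + (if l = k then (1 : ℂ) else 0) * (if m = i then (1 : ℂ) else 0) * (if n = j then (1 : ℂ) else 0)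
      - (if l = k then (1 : ℂ) else 0) * (if m = j then (1 : ℂ) else 0) * (if n = i then (1 : ℂ) else 0) := rfl

omit [Fintype ι] in
/-- Entries of the `T2` functional (the printed formula, Nakata et al. (2008) §II.A; `rfl`).
[cite: NakataEtAl2008, §II.A] -/
theorem t2Map_apply (γ : Matrix ι ι ℂ) (Γ : Matrix (ι × ι) (ι × ι) ℂ) (i j k l m n : ι) :
    t2Map γ Γ (i, j, k) (l, m, n) =
      (if k = n then (1 : ℂ) else 0) * Γ (i, j) (l, m)
      - (if l = i then (1 : ℂ) else 0) * Γ (n, j) (k, m)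
      + (if l = j then (1 : ℂ) else 0) * Γ (n, i) (k, m)
      + (if m = i then (1 : ℂ) else 0) * Γ (n, j) (k, l)
      - (if m = j then (1 : ℂ) else 0) * Γ (n, i) (k, l)
      + (if l = i then (1 : ℂ) else 0) * (if m = j then (1 : ℂ) else 0) * γ n k
      - (if l = j then (1 : ℂ) else 0) * (if m = i then (1 : ℂ) else 0) * γ n k := rfl

/-- On the reduced density matrices of a UNIT vector the `T1` functional is the `T1` matrix of the state
in anticommutator form, `³D + ³Qᵀ` (`t1_entry_eq_rdm`). Nakata et al. (2008) §II.A.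
[cite: NakataEtAl2008, §II.A] -/
theorem t1Map_rdm {ψ : Fock ι} (hψ1 : star ψ ⬝ᵥ ψ = 1) :
    t1Map (oneRDM ψ) (twoRDM ψ) = metricMatrix threeCreate ψ + (metricMatrix threeAnnihilate ψ)ᵀ := by
  ext ⟨i, j, k⟩ ⟨l, m, n⟩
  rw [t1Map_apply, t1_entry_eq_rdm, hψ1]
  simp only [mul_one]

/-- On the reduced density matrices of any vector the `T2` functional is the `T2` matrix of the state in
anticommutator form (`t2_entry_eq_rdm`). Nakata et al. (2008) §II.A. [cite: NakataEtAl2008, §II.A] -/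
theorem t2Map_rdm (ψ : Fock ι) :
    t2Map (oneRDM ψ) (twoRDM ψ) = metricMatrix twoCreateAnnihilate ψ +
      (metricMatrix (fun t : ι × ι × ι => (twoCreateAnnihilate t)ᴴ) ψ)ᵀ := by
  ext ⟨i, j, k⟩ ⟨l, m, n⟩
  rw [t2Map_apply, t2_entry_eq_rdm]

/-- On the reduced density matrices of any vector the `T2′` block matrix is the `T2′` matrix
`M(C′) + M(C″)ᵀ` of `ThreeIndexConditionsT2Prime.lean` (blocks: `t2Prime_apply_inl_inl`,
`t2Prime_apply_inl_inr`, `t2Prime_apply_inr_inl`, `t2Prime_apply_inr_inr`). Nakata et al. (2008) §II.B.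
[cite: NakataEtAl2008, §II.B] -/
theorem t2PrimeMap_rdm (ψ : Fock ι) :
    t2PrimeMap (oneRDM ψ) (twoRDM ψ) =
      metricMatrix (Sum.elim twoCreateAnnihilate creation) ψ +
        (metricMatrix (Sum.elim (fun t : ι × ι × ι => (twoCreateAnnihilate t)ᴴ)
          (0 : ι → Matrix (Finset ι) (Finset ι) ℂ)) ψ)ᵀ := by
  ext I J
  rcases I with ⟨i, j, k⟩ | l <;> rcases J with ⟨l', m, n⟩ | l''
  · rw [t2PrimeMap, fromBlocks_apply₁₁, t2Map_rdm, t2Prime_apply_inl_inl]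
  · rw [t2PrimeMap, fromBlocks_apply₁₂, Matrix.of_apply, t2Prime_apply_inl_inr]
  · rw [t2PrimeMap, fromBlocks_apply₂₁, Matrix.of_apply, t2Prime_apply_inr_inl]
  · rw [t2PrimeMap, fromBlocks_apply₂₂, t2Prime_apply_inr_inr]

/-! ### The `PQGT1T2′`-feasible set -/

/-- **The feasible set of the `PQGT1T2′` programme for `N` electrons** (Nakata et al. (2008) §II.A–C):
DQG feasibility (`IsDQGFeasible`: `D, Q, G ⪰ 0`, Hermiticity, trace, contraction, antisymmetry)
together with the three-index conditions `T1 ⪰ 0` and `T2′ ⪰ 0` on the abstract pair `(γ, Γ)`.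
[cite: NakataEtAl2008, §II.A-C] -/
structure IsDQGT1T2PrimeFeasible (N : ℕ) (γ : Matrix ι ι ℂ) (Γ : Matrix (ι × ι) (ι × ι) ℂ) : Prop
    extends IsDQGFeasible N γ Γ where
  /-- the `T1` condition. [cite: NakataEtAl2008, §II.A] -/
  t1_psd : (t1Map γ Γ).PosSemidef
  /-- the `T2′` condition. [cite: NakataEtAl2008, §II.B] -/
  t2Prime_psd : (t2PrimeMap γ Γ).PosSemidef

/-- **`T2′` implies `T2`** ("`T2′` condition is obtained by slightly strengthening `T2`"): on the
`PQGT1T2′`-feasible set the `T2` functional is positive semidefinite, being the principal `(ijk)`-block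
of `T2′`; this is the inclusion `PQGT1T2′ ⊆ PQGT1T2` behind `E_PQGT1T2 ≤ E_PQGT1T2′`.
Nakata et al. (2008) §II.B–C. [cite: NakataEtAl2008, §II.B-C] -/
theorem IsDQGT1T2PrimeFeasible.t2Map_posSemidef {N : ℕ} {γ : Matrix ι ι ℂ}
    {Γ : Matrix (ι × ι) (ι × ι) ℂ} (h : IsDQGT1T2PrimeFeasible N γ Γ) : (t2Map γ Γ).PosSemidef := by
  have hsub := h.t2Prime_psd.submatrix (Sum.inl : ι × ι × ι → (ι × ι × ι) ⊕ ι)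
  have heq : (t2PrimeMap γ Γ).submatrix Sum.inl Sum.inl = t2Map γ Γ := by
    ext I J
    rw [submatrix_apply, t2PrimeMap, fromBlocks_apply₁₁]
  rwa [heq] at hsub

/-- **The inclusion `PQGT1T2′ ⊆ PQG` in bound form** ("there are obvious inclusion relations … hence
`E_PQG ≤ E_PQGT1 ≤ E_PQGT1T2 ≤ E_PQGT1T2′`"): whatever lies below a functional on the DQG-feasible set
lies below it on the `PQGT1T2′`-feasible set. Nakata et al. (2008) §II.C. [cite: NakataEtAl2008, §II.C] -/
theorem forall_isDQGT1T2PrimeFeasible_of_forall_isDQGFeasible {N : ℕ}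
    {E : Matrix ι ι ℂ → Matrix (ι × ι) (ι × ι) ℂ → ℝ} {c : ℝ}
    (hc : ∀ γ Γ, IsDQGFeasible N γ Γ → c ≤ E γ Γ) :
    ∀ γ Γ, IsDQGT1T2PrimeFeasible N γ Γ → c ≤ E γ Γ :=
  fun γ Γ h => hc γ Γ h.toIsDQGFeasible

/-- **The three-index conditions are NECESSARY**: the reduced density matrices of every unit `N`-particle
vector are `PQGT1T2′`-feasible (`IsDQGFeasible.of_state`, `t1Transpose_posSemidef`,
`t2Prime_posSemidef`). Nakata et al. (2008) §II.A–B (Erdahl 1978). [cite: NakataEtAl2008, §II.A-B] -/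
theorem IsDQGT1T2PrimeFeasible.of_state {N : ℕ} {ψ : Fock ι} (hψN : IsNParticle N ψ)
    (hψ1 : star ψ ⬝ᵥ ψ = 1) : IsDQGT1T2PrimeFeasible N (oneRDM ψ) (twoRDM ψ) where
  toIsDQGFeasible := IsDQGFeasible.of_state hψN hψ1
  t1_psd := by rw [t1Map_rdm hψ1]; exact t1Transpose_posSemidef ψ
  t2Prime_psd := by rw [t2PrimeMap_rdm]; exact t2Prime_posSemidef ψ

end Abstract

/-! ### The relaxation bounds -/

section Molecular

variable {Λ : Type*} [LinearOrder Λ] [Fintype Λ]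

/-- **`E_PQGT1T2′ ≤ E_fullCI` (`N`-electron form).** If a real number `c` lies below the energy
functional `rdmEnergy` on every `PQGT1T2′`-feasible pair for `N` electrons (`N ≤ 2|Λ|`) — in particular
the optimal value of that semidefinite programme, or any certified lower bound of it — then
`c ≤ E₀(Ĥ; N)`, the exact (full-CI) ground-state energy of the `N`-electron sector of the spin-orbital
basis. Nakata et al. (2008) §II.C. [cite: NakataEtAl2008, §II.C] -/
theorem le_groundEnergy_of_forall_isDQGT1T2PrimeFeasible (h : Λ → Λ → ℂ) (g : Λ → Λ → Λ → Λ → ℂ)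
    (hnuc : ℂ) {N : ℕ} (hN : N ≤ Fintype.card (Orb Λ)) {c : ℝ}
    (hc : ∀ γ Γ, IsDQGT1T2PrimeFeasible N γ Γ → c ≤ (rdmEnergy h g hnuc γ Γ).re) :
    c ≤ Literature.MathematicalPhysics.QuantumLattice.groundEnergy (molecularHamiltonian h g hnuc) N := by
  unfold Literature.MathematicalPhysics.QuantumLattice.groundEnergy
  refine le_csInf (ThermodynamicLimit.groundEnergySet_nonempty _ hN) ?_
  rintro E ⟨ψ, hψN, hψ1, rfl⟩
  have hE := hc _ _ (IsDQGT1T2PrimeFeasible.of_state hψN hψ1)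
  rwa [rdmEnergy_rdm h g hnuc hψ1] at hE

/-- **The feasible set of the `PQGT1T2′` programme WITH SECTOR ROWS** `(N_α, N_β) = (a, b)`:
sector-DQG feasibility (`IsDQGFeasibleSector`: DQG at `N = a + b`, `S_z` selection rule, spin-resolved
traces) together with `T1 ⪰ 0` and `T2′ ⪰ 0`. Nakata et al. (2008) §II.A–C with Mazziotti (2007) §II.F.
[cite: NakataEtAl2008, §II.A-C] -/
structure IsDQGT1T2PrimeFeasibleSector (a b : ℕ) (γ : Matrix (Orb Λ) (Orb Λ) ℂ)
    (Γ : Matrix (Orb Λ × Orb Λ) (Orb Λ × Orb Λ) ℂ) : Prop extends IsDQGFeasibleSector a b γ Γ where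
  /-- the `T1` condition. [cite: NakataEtAl2008, §II.A] -/
  t1_psd : (t1Map γ Γ).PosSemidef
  /-- the `T2′` condition. [cite: NakataEtAl2008, §II.B] -/
  t2Prime_psd : (t2PrimeMap γ Γ).PosSemidef

/-- The sector form forgets to the `N = a + b` form. [cite: NakataEtAl2008, §II.A-C] -/
theorem IsDQGT1T2PrimeFeasibleSector.isDQGT1T2PrimeFeasible {a b : ℕ} {γ : Matrix (Orb Λ) (Orb Λ) ℂ}
    {Γ : Matrix (Orb Λ × Orb Λ) (Orb Λ × Orb Λ) ℂ} (h : IsDQGT1T2PrimeFeasibleSector a b γ Γ) :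
    IsDQGT1T2PrimeFeasible (a + b) γ Γ where
  toIsDQGFeasible := h.dqg
  t1_psd := h.t1_psd
  t2Prime_psd := h.t2Prime_psd

/-- **The sector three-index conditions are NECESSARY**: the reduced density matrices of every unit vector
of the sector `(N_α, N_β) = (a, b)` are sector-`PQGT1T2′`-feasible. Nakata et al. (2008) §II.A–B;
Mazziotti (2007) §II.F. [cite: NakataEtAl2008, §II.A-B] -/
theorem IsDQGT1T2PrimeFeasibleSector.of_state {a b : ℕ} {ψ : Fock (Orb Λ)} (hψ : IsInSector a b ψ)
    (hψ1 : star ψ ⬝ᵥ ψ = 1) : IsDQGT1T2PrimeFeasibleSector a b (oneRDM ψ) (twoRDM ψ) where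
  toIsDQGFeasibleSector := IsDQGFeasibleSector.of_state hψ hψ1
  t1_psd := by rw [t1Map_rdm hψ1]; exact t1Transpose_posSemidef ψ
  t2Prime_psd := by rw [t2PrimeMap_rdm]; exact t2Prime_posSemidef ψ

/-- **`E_PQGT1T2′ ≤ E_fullCI` (sector form).** For Hermitian integral data and a non-trivial sector
`a, b ≤ |Λ|`: if `c` lies below the energy functional on every sector-`PQGT1T2′`-feasible pair, then
`c ≤ E₀(Ĥ; N_α = a, N_β = b)` (`sectorGroundEnergy`) — the quantity bounded by the
certified-quantum-chemistry `DQGT1T2′` rows. Nakata et al. (2008) §II.C. [cite: NakataEtAl2008, §II.C] -/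
theorem le_sectorGroundEnergy_of_forall_isDQGT1T2PrimeFeasibleSector {h : Λ → Λ → ℂ}
    {g : Λ → Λ → Λ → Λ → ℂ} {hnuc : ℂ} (hH : (molecularHamiltonian h g hnuc).IsHermitian) {a b : ℕ}
    (ha : a ≤ Fintype.card Λ) (hb : b ≤ Fintype.card Λ) {c : ℝ}
    (hc : ∀ γ Γ, IsDQGT1T2PrimeFeasibleSector a b γ Γ → c ≤ (rdmEnergy h g hnuc γ Γ).re) :
    c ≤ sectorGroundEnergy (molecularHamiltonian h g hnuc) a b := by
  obtain ⟨ψ, hψ, hψ1, hHψ⟩ := exists_unit_eigen_sectorGroundEnergy hH ha hb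
  have hE := hc _ _ (IsDQGT1T2PrimeFeasibleSector.of_state hψ hψ1)
  rw [rdmEnergy_rdm h g hnuc hψ1, hHψ, dotProduct_smul, hψ1, smul_eq_mul, mul_one,
    Complex.ofReal_re] at hE
  exact hE

/-- The sector bound needs only a bound on the DQG-sector-feasible set (inclusion of feasible sets,
Nakata et al. (2008) §II.C): the `DQGT1T2′` rows are at least as tight as the `DQG` rows.
[cite: NakataEtAl2008, §II.C] -/
theorem forall_isDQGT1T2PrimeFeasibleSector_of_forall_isDQGFeasibleSector {a b : ℕ}
    {E : Matrix (Orb Λ) (Orb Λ) ℂ → Matrix (Orb Λ × Orb Λ) (Orb Λ × Orb Λ) ℂ → ℝ} {c : ℝ}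
    (hc : ∀ γ Γ, IsDQGFeasibleSector a b γ Γ → c ≤ E γ Γ) :
    ∀ γ Γ, IsDQGT1T2PrimeFeasibleSector a b γ Γ → c ≤ E γ Γ :=
  fun γ Γ h => hc γ Γ h.toIsDQGFeasibleSector

end Molecular

end Literature.MathematicalPhysics.QuantumChemistry

end
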